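import Summits.CriticalPhenomena.SAWScalingLimit.Theorems.SAWDevelopingMapInteriorFlatteningLiouvilleLastExit
import Summits.CriticalPhenomena.SAWScalingLimit.Theorems.SAWDevelopingMapInteriorFlatteningLiouvilleReductionA
import Summits.CriticalPhenomena.SAWScalingLimit.Theorems.SAWDevelopingMapInteriorFlatteningFactorisation
import Summits.CriticalPhenomena.SAWScalingLimit.Theorems.SAWDevelopingMapInteriorFlatteningOneScaleGlue
import Literature.Probability.LatticeModels.TriangularLatticeProofs

/-!
# Bridge: the windowed far-field coherence of line `liouville-local-limits` (S6) from that of `one-mouth-ball-reduction` (S3')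

Crux `stmt-CriticalPhenomena-8297` (`…Theses.SAWDevelopingMap.InteriorFlattening`), lead `prover-line-stmt-CriticalPhenomena-8297-c1-0`.
The two lines attacking the crux carry the SAME one-scale far-field bet in two coordinate systems: one-mouth's windowed S3'
(configurations `(D', (u,u'))` of the sub-ball `ball Λ v r`, the hypothesis `h3` of the landed `OneMouth.depthFlat_of_atoms`) and
this line's windowed S6 (pictures `(I, (y,z)) ∈ Pic S` of the lattice ball `latticeBall S` around `O`). This file proves
`farFieldCoherence_of_oneMouthCoherence` (registered sub-goal): S3' ⇒ S6, by the re-indexing `(D', d) ↦ (S' ∖ D', d)`,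
`S' = Λ ∩ B_S(O) = B_S(O)` of the landed `…LiouvilleLastExit` (S4), at `v = O`, `r = S`, frame `(A, B, C)`: the left sides agree
termwise (pictures outside the image carry amplitude `0` or a dead inner domain), and the right side `Σ_c amp_c · mono_c` is
`M(O) = obsMono Λ a` by the landed factorisation `OneMouth.stub_factorisation` summed over the star of `O`. Consequently the landed
sufficient condition `OneMouth.farFieldCoherence_of_phaseConcentration` (PC ⇒ S3') also feeds S6, and a disproof of either bet kills both.
-/

noncomputable section

open scoped BigOperators
open Literature.Probability.LatticeModels Literature.Probability.RandomPlanarGeometry.SAW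

namespace Summit.CriticalPhenomena.SAWScalingLimit.Theorems.InteriorFlattening.Liouville

namespace CoherenceBridge

/-- For `B_{2S}(O) ⊆ Λ` (any `S`, in fact whenever `latticeBall S ⊆ Λ`) the sub-ball of the sibling line is the lattice ball:
`OneMouth.ball Λ O S = Λ ∩ latticeBall S = latticeBall S`. -/
theorem ball_eq (Λ : Finset HexVertex) (S : ℝ) : OneMouth.ball Λ O S = Λ ∩ latticeBall S := by
  ext w
  simp only [OneMouth.ball, Finset.mem_filter, Finset.mem_inter, mem_latticeBall_iff]

/-- `latticeBall S ⊆ Λ` once `O` is `2S`-deep and `0 ≤ S`. -/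
theorem latticeBall_subset {Λ : Finset HexVertex} {S : ℝ} (hS : 0 ≤ S) (hdeep : Deep Λ O (2 * S)) :
    latticeBall S ⊆ Λ := fun w hw =>
  hdeep w ((mem_latticeBall_iff.1 hw).trans (by linarith))

/-- The prefix amplitudes of the two lines agree on re-indexed configurations. -/
theorem amp_toPic {Λ S' D' : Finset HexVertex} {a : Sym2 HexVertex} {S : ℝ} {d : HexVertex × HexVertex}
    (hS' : S' = Λ ∩ latticeBall S) (hD' : D' ⊆ S') :
    amp Λ a S (S' \ D', d) = OneMouth.amp Λ a S' (D', d) := by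
  show (∑ ψ : HexMidEdgeSAW Λ a s(d.1, d.2),
      if ψ.verts.getLast? = some d.1 ∧ ψ.verts.toFinset ∩ latticeBall S = S' \ D'
      then ψ.weight xc (5 / 8) else 0) =
    ∑ ψ : HexMidEdgeSAW Λ a s(d.1, d.2),
      if ψ.verts.getLast? = some d.1 ∧ S' \ ψ.verts.toFinset = D' then ψ.weight xc (5 / 8) else 0
  refine Finset.sum_congr rfl fun ψ _ => if_congr ?_ rfl rfl
  have hV : ψ.verts.toFinset ⊆ Λ := fun v hv => ψ.subset v (List.mem_toFinset.1 hv)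
  exact and_congr_right fun _ => LastExit.inter_eq_sdiff_iff hV hS' hD'

/-- The inner monopoles agree: for `S' = latticeBall S` and `D' ⊆ S'`, the domain-free picture domain of `(S' ∖ D', d)` is `D'`. -/
theorem picMono_toPic {S' D' : Finset HexVertex} {S : ℝ} {d : HexVertex × HexVertex}
    (hS' : S' = latticeBall S) (hD' : D' ⊆ S') :
    picMono S (S' \ D', d) = OneMouth.mono D' (OneMouth.root (D', d)) O nbA nbB nbC := by
  have hdom : latticeBall S \ (S' \ D') = D' := by rw [← hS']; exact Finset.sdiff_sdiff_eq_self hD'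
  simp only [picMono, fieldMono, picField, picRoot, OneMouth.mono, OneMouth.root, hdom]
  rfl

/-- Pictures outside the image of the re-indexing contribute `0` to the coherent-weight sum. -/
theorem term_eq_zero {Λ S' : Finset HexVertex} {a : Sym2 HexVertex} {S : ℝ} (hS' : S' = Λ ∩ latticeBall S)
    (hball : latticeBall S ⊆ Λ) {P : Picture} (hP : P ∈ Pic S)
    (hnot : P ∉ (OneMouth.Conf Λ S').image fun c => (S' \ c.1, c.2)) :
    ‖amp Λ a S P‖ * ‖picMono S P‖ = 0 := by
  by_cases hy : P.2.1 ∈ Λ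
  swap
  · rw [LastExit.amp_eq_zero (Or.inl hy), norm_zero, zero_mul]
  by_cases hI : P.1 ⊆ Λ ∩ latticeBall S
  swap
  · rw [LastExit.amp_eq_zero (Or.inr hI), norm_zero, zero_mul]
  by_cases hz : P.2.2 ∈ P.1
  · rw [Reduction.picMono_eq_zero_of_mem hP hz, norm_zero, mul_zero]
  -- otherwise `P` is the image of `(S' ∖ P.1, P.2)`
  exfalso
  refine hnot (Finset.mem_image.2 ⟨(S' \ P.1, P.2), ?_, ?_⟩)
  · have hmem := hP
    simp only [Pic, darts, Finset.mem_product, Finset.mem_powerset, Finset.mem_filter, Finset.mem_sdiff] at hmem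
    obtain ⟨-, ⟨⟨-, hyS⟩, hzS⟩, hadj⟩ := hmem
    simp only [OneMouth.Conf, OneMouth.entr, Finset.mem_product, Finset.mem_powerset, Finset.mem_filter, hS',
      Finset.mem_inter]
    exact ⟨Finset.sdiff_subset, ⟨hy, hball hzS, hzS⟩, fun h => hyS h.2, hadj⟩
  · simp only [hS'] at hI ⊢
    rw [Finset.sdiff_sdiff_eq_self hI]

/-- **The monopole at `O` is the coherent superposition `Σ_c amp_c · mono_c`** (the sibling line's factorisation summed over the
star of `O`), for `S' = Λ ∩ B_S(O)`, `S ≥ 1`, `O` `2S`-deep. -/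
theorem obsMono_eq_sum {Λ : Finset HexVertex} {a : Sym2 HexVertex} {S : ℝ} (hS : 1 ≤ S) (ha : a ∈ hexDomainBoundary Λ)
    (hdeep : Deep Λ O (2 * S)) :
    obsMono Λ a = ∑ c ∈ OneMouth.Conf Λ (Λ ∩ latticeBall S),
      OneMouth.amp Λ a (Λ ∩ latticeBall S) c * OneMouth.mono c.1 (OneMouth.root c) O nbA nbB nbC := by
  have hball : latticeBall S ⊆ Λ := latticeBall_subset (by linarith) hdeep
  have hoff : ∀ t ∈ a, t ∉ Λ ∩ latticeBall S := fun t ht h =>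
    Reduction.root_not_mem_latticeBall ha hdeep hS t ht (Finset.mem_inter.1 h).2
  have hO : O ∈ Λ ∩ latticeBall S := Finset.mem_inter.2 ⟨hball (Reduction.O_mem_latticeBall (by linarith)), Reduction.O_mem_latticeBall (by linarith)⟩
  have hnb : ∀ {w}, hexGraph.Adj O w → w ∈ Λ ∩ latticeBall S := fun hw =>
    Finset.mem_inter.2 ⟨hball (Reduction.mem_latticeBall_of_adj_O hw hS), Reduction.mem_latticeBall_of_adj_O hw hS⟩
  have hA := Reduction.adj_O_nbA; have hB := Reduction.adj_O_nbB; have hC := Reduction.adj_O_nbC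
  have fA := OneMouth.stub_factorisation Λ (Λ ∩ latticeBall S) a O nbA Finset.inter_subset_left hoff hO (hnb hA)
  have fB := OneMouth.stub_factorisation Λ (Λ ∩ latticeBall S) a O nbB Finset.inter_subset_left hoff hO (hnb hB)
  have fC := OneMouth.stub_factorisation Λ (Λ ∩ latticeBall S) a O nbC Finset.inter_subset_left hoff hO (hnb hC)
  simp only [obsMono, fieldMono, LastExit.obs_eq_Fobs, fA, fB, fC, OneMouth.mono, mul_add, Finset.sum_add_distrib]

end CoherenceBridge

open CoherenceBridge in
/-- **S6 of this line from S3' of the sibling line** (registered sub-goal): the windowed far-field coherence in picture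
coordinates follows from the windowed far-field coherence in one-mouth configuration coordinates (with `K = A`, `S₁ = 1`). -/
theorem farFieldCoherence_of_oneMouthCoherence :
    (∃ A : ℝ, 0 < A ∧ ∀ Λ : Finset HexVertex, hexDomainSimplyConnected Λ →
      ∀ a ∈ hexDomainBoundary Λ, ∀ v ∈ Λ, ∀ r : ℝ, 1 ≤ r → OneMouth.Deep Λ v (2 * r) → ¬ OneMouth.Deep Λ v (4 * r) →
      ∀ w₀ w₁ w₂ : HexVertex, OneMouth.IsStar v w₀ w₁ w₂ →
        (∑ c ∈ OneMouth.Conf Λ (OneMouth.ball Λ v r),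
            ‖OneMouth.amp Λ a (OneMouth.ball Λ v r) c‖ * ‖OneMouth.mono c.1 (OneMouth.root c) v w₀ w₁ w₂‖) ≤
          A * ‖∑ c ∈ OneMouth.Conf Λ (OneMouth.ball Λ v r),
            OneMouth.amp Λ a (OneMouth.ball Λ v r) c * OneMouth.mono c.1 (OneMouth.root c) v w₀ w₁ w₂‖) →
    ∃ K S₁ : ℝ, ∀ S : ℝ, S₁ ≤ S → ∀ (Λ : Finset HexVertex) (a : Sym2 HexVertex),
      hexDomainSimplyConnected Λ → a ∈ hexDomainBoundary Λ → Deep Λ O (2 * S) → ¬ Deep Λ O (4 * S) →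
        ∑ P ∈ Pic S, ‖amp Λ a S P‖ * ‖picMono S P‖ ≤ K * ‖obsMono Λ a‖ := by
  rintro ⟨A, -, h3⟩
  refine ⟨A, 1, fun S hS Λ a hΛ ha hdeep hndeep => ?_⟩
  have hball : latticeBall S ⊆ Λ := latticeBall_subset (by linarith) hdeep
  have hS'eq : Λ ∩ latticeBall S = latticeBall S := Finset.inter_eq_right.2 hball
  have hO : O ∈ Λ := hball (Reduction.O_mem_latticeBall (by linarith))
  have hstar : OneMouth.IsStar O nbA nbB nbC := by
    refine ⟨Reduction.adj_O_nbA, Reduction.adj_O_nbB, Reduction.adj_O_nbC, ?_, ?_, ?_⟩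
    · intro h; have := congrArg (fun p : HexVertex => p.1 0) h; simp [nbA, nbB] at this
    · intro h; have := congrArg (fun p : HexVertex => p.1 0) h; simp [nbB, nbC] at this
    · intro h; have := congrArg (fun p : HexVertex => p.1 1) h; simp [nbA, nbC] at this
  have key := h3 Λ hΛ a ha O hO S hS hdeep hndeep nbA nbB nbC hstar
  rw [ball_eq, ← obsMono_eq_sum hS ha hdeep] at key
  -- re-index the left side
  have hL : ∑ P ∈ Pic S, ‖amp Λ a S P‖ * ‖picMono S P‖ =
      ∑ c ∈ OneMouth.Conf Λ (Λ ∩ latticeBall S),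
        ‖OneMouth.amp Λ a (Λ ∩ latticeBall S) c‖ * ‖OneMouth.mono c.1 (OneMouth.root c) O nbA nbB nbC‖ := by
    have himg : ((OneMouth.Conf Λ (Λ ∩ latticeBall S)).image fun c => ((Λ ∩ latticeBall S) \ c.1, c.2)) ⊆ Pic S := by
      intro P hP
      obtain ⟨c, hc, rfl⟩ := Finset.mem_image.1 hP
      exact LastExit.toPic_mem_Pic hc
    rw [← Finset.sum_subset himg fun P hP hnot => term_eq_zero rfl hball hP hnot,
      Finset.sum_image (LastExit.toPic_injOn Λ (Λ ∩ latticeBall S))]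
    refine Finset.sum_congr rfl fun c hc => ?_
    have hD' : c.1 ⊆ Λ ∩ latticeBall S := by
      simp only [OneMouth.Conf, Finset.mem_product, Finset.mem_powerset] at hc; exact hc.1
    rw [show ((Λ ∩ latticeBall S) \ c.1, c.2) = ((Λ ∩ latticeBall S) \ c.1, (c.2.1, c.2.2)) from rfl,
      amp_toPic rfl hD', picMono_toPic hS'eq hD']
  rw [hL]
  exact key


end Summit.CriticalPhenomena.SAWScalingLimit.Theorems.InteriorFlattening.Liouville

end
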